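import Literature.Analysis.FluidPDE.TaoClassQuotientBalance
import Literature.Analysis.FluidPDE.Wei2016WeightedBalance
import HarnessLib

/-!
# Wei 2016, §3: the energy `A(t) = ‖J‖² + ½ε^{2/3}‖Ω‖²` along a Tao-class axisymmetric solution —
# continuity, and `A(t) − A(s) = ∫ₛᵗ (2∫JJ' + ε^{2/3}∫ΩΩ')`

Analysis/FluidPDE proof file (theorems only; no definitions, no named facts) on the way to
`Literature.Analysis.FluidPDE.Wei2016_logModulus_regularity`
(`LeiZhang2017AxisymmetricCriteria.lean`), after D. Wei, J. Math. Anal. Appl. 435 (2016) =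
arXiv:1508.03318, §3: "(3.6) `d/dt A(t) + … ≤ …`, `A = ‖J‖² + ½ε^{2/3}‖Ω‖²`", to be combined
with the ODE comparison of the proof of Thm. 1.1 ("`d/dt F(A) ≥ −CM₂‖∇u(t)‖²`").

The tree has the `L²` balances `∫Ω(b)² = ∫Ω(0)² + 2∫_{(0,b)}∫ΩΩ'`, `∫J(b)² = …`
(`IsTaoSolutionOn.integral_sq_angVortQuot_eq / _radVelQuot_curl_eq`, `TaoClassQuotientBalance`).
The ODE comparison (`Wei2016.F_sub_le_F_of_integral_le`) needs in addition the **integrability in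
time** of the densities `t ↦ ∫ΩΩ'`, `t ↦ ∫JJ'` on `(0, T)` and the **continuity** of
`t ↦ ∫Ω(t)²`, `∫J(t)²` on `[0, T]`; this file re-derives the balances through
`Wei2016.weighted_sq_balance` (weight `ρ = r⁻²`, jointly smooth numerators `⟪Jx, ω⟫ = r²Ω`,
`x₀ω₀ + x₁ω₁ = r²J`), which supplies all three:

* `IsTaoSolutionOn.weighted_balance_of_repr` — the common statement for a quotient
  `g = r⁻²⟪a, ω⟫` (`a` smooth);
* `IsTaoSolutionOn.angVortQuot_balance`, `IsTaoSolutionOn.radVelQuot_curl_balance` — `Ω`, `J`;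
* `IsTaoSolutionOn.energyA_balance` — for `A(t) = ∫J(t)² + β∫Ω(t)²` (`β ∈ ℝ`): `A` is continuous
  on `[0, T]`, the density `φ = 2∫JJ' + 2β∫ΩΩ'` is integrable on `(0, T)`, and
  `A(t) − A(s) = ∫ₛᵗ φ` for `0 ≤ s ≤ t ≤ T`.

## References

* D. Wei, arXiv:1508.03318, §3 (3.6) and the proof of Thm. 1.1. [Wei2016]
* Z. Lei, Q. S. Zhang, arXiv:1505.02628, §3 pp. 8–9 (integration in time). [LeiZhang2017]
-/

noncomputable section

open MeasureTheory Set Function Filter Topology InnerProductSpace WithLp intervalIntegral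
open scoped RealInnerProductSpace ContDiff ENNReal NNReal Topology

namespace Literature.Analysis.FluidPDE

section Balance

variable {T ν : ℝ} {u₀ : EuclideanSpace ℝ (Fin 3) → EuclideanSpace ℝ (Fin 3)}
  {v : ℝ → EuclideanSpace ℝ (Fin 3) → EuclideanSpace ℝ (Fin 3)} {q : ℝ → EuclideanSpace ℝ (Fin 3) → ℝ}

/-- **Weighted `L²` balance of a quotient `g = r⁻²⟪a, ω⟫` along a Tao-class solution, with
integrability and continuity in time.** Let `a` be a smooth vector field and `g, g'` real
families with `g t x = r⁻²⟪a x, ω(t,x)⟫`, `g' t x = r⁻²⟪a x, curl (∂ₜv t) x⟫` off the axis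
(`t ∈ [0, T]`), continuous slices and uniform `L²` bounds `∫ g(t)², ∫ g'(t)² ≤ C`. Then
`t ↦ ∫ 2 g g'` is integrable on `(0, T)`, `t ↦ ∫ g(t)²` is continuous on `[0, T]`, and
`∫ g(b)² = ∫ g(0)² + ∫₀ᵇ ∫ 2 g g'` for `b ∈ (0, T]`. [folklore] -/
theorem IsTaoSolutionOn.weighted_balance_of_repr (h : IsTaoSolutionOn T ν u₀ v q) (hT : 0 < T)
    {g g' : ℝ → EuclideanSpace ℝ (Fin 3) → ℝ} {a : EuclideanSpace ℝ (Fin 3) → EuclideanSpace ℝ (Fin 3)}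
    (ha : ContDiff ℝ ∞ a)
    (hg : ∀ t ∈ Icc 0 T, ∀ x, cylRadius x ≠ 0 →
      g t x = (cylRadius x ^ 2)⁻¹ * ⟪a x, vorticity v t x⟫)
    (hg' : ∀ t ∈ Icc 0 T, ∀ x, cylRadius x ≠ 0 →
      g' t x = (cylRadius x ^ 2)⁻¹ * ⟪a x, curl (timeDerivWithin (Icc 0 T) v t) x⟫)
    {C : ℝ≥0} (hgb : ∀ t ∈ Icc 0 T, ∫⁻ x, ‖g t x‖ₑ ^ 2 ≤ C) (hg'b : ∀ t ∈ Icc 0 T, ∫⁻ x, ‖g' t x‖ₑ ^ 2 ≤ C) :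
    IntegrableOn (fun t => ∫ x, 2 * g t x * g' t x) (Ioo 0 T) ∧
    ContinuousOn (fun t => ∫ x, g t x ^ 2) (Icc 0 T) ∧
    ∀ b ∈ Ioc 0 T, ∫ x, g b x ^ 2 = (∫ x, g 0 x ^ 2) + ∫ t in (0 : ℝ)..b, ∫ x, 2 * g t x * g' t x := by
  have hU : UniqueDiffOn ℝ (Icc 0 T) := uniqueDiffOn_Icc hT
  have hcl := Icc_subset_closure_interior_Icc' (T := T) hT
  have hsm : IsSmoothSpaceTimeOn (Icc 0 T) v := h.classical.smooth_velocity
  have hω : IsSmoothSpaceTimeOn (Icc 0 T) (vorticity v) := hsm.isSmoothSpaceTimeOn_vorticity hU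
  have hcurl : ∀ t ∈ Icc 0 T, timeDerivWithin (Icc 0 T) (vorticity v) t =
      curl (timeDerivWithin (Icc 0 T) v t) := fun t ht => hsm.timeDerivWithin_vorticity_eq hU hcl ht
  -- the jointly smooth numerator `G t x = ⟪a x, ω t x⟫` and the weight `ρ = r⁻²`
  set G : ℝ → EuclideanSpace ℝ (Fin 3) → ℝ := fun t x => ⟪a x, vorticity v t x⟫ with hG
  have hGsm : IsSmoothSpaceTimeOn (Icc 0 T) G := (isSmoothSpaceTimeOn_const_time ha _).inner hω
  set ρ : EuclideanSpace ℝ (Fin 3) → ℝ := fun x => (cylRadius x ^ 2)⁻¹ with hρ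
  have hρm : Measurable ρ := (continuous_cylRadius.measurable.pow_const 2).inv
  -- the time derivative of `G`
  have hG' : ∀ t ∈ Icc 0 T, ∀ x, timeDerivWithin (Icc 0 T) G t x =
      ⟪a x, curl (timeDerivWithin (Icc 0 T) v t) x⟫ := by
    intro t ht x
    rw [← hcurl t ht, timeDerivWithin_apply]
    have hd : HasDerivWithinAt (fun s => vorticity v s x) (timeDerivWithin (Icc 0 T) (vorticity v) t x)
        (Icc 0 T) t := hω.hasDerivWithinAt_timeDerivWithin hU ht x
    have h1 : HasDerivWithinAt (fun s => ⟪a x, vorticity v s x⟫)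
        ⟪a x, timeDerivWithin (Icc 0 T) (vorticity v) t x⟫ (Icc 0 T) t := by
      have := (innerSL ℝ (a x)).hasFDerivAt.comp_hasDerivWithinAt t hd
      simpa [Function.comp_def] using this
    exact h1.derivWithin (hU t ht)
  -- a.e. identifications
  have hae : ∀ᵐ x ∂(volume : Measure (EuclideanSpace ℝ (Fin 3))), cylRadius x ≠ 0 := by
    rw [ae_iff]; simp only [ne_eq, not_not]; exact volume_setOf_cylRadius_eq_zero
  have e0 : ∀ t ∈ Icc 0 T, ∀ᵐ x ∂(volume : Measure (EuclideanSpace ℝ (Fin 3))), ρ x * G t x = g t x :=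
    fun t ht => hae.mono fun x hx => by rw [hg t ht x hx]
  have e1 : ∀ t ∈ Icc 0 T, ∀ᵐ x ∂(volume : Measure (EuclideanSpace ℝ (Fin 3))),
      ρ x * timeDerivWithin (Icc 0 T) G t x = g' t x :=
    fun t ht => hae.mono fun x hx => by rw [hG' t ht x, hg' t ht x hx]
  -- the sup bounds transfer
  have hC₀ : ∀ t ∈ Icc 0 T, ∫⁻ x, ‖ρ x * G t x‖ₑ ^ 2 ≤ C := fun t ht => by
    rw [lintegral_congr_ae ((e0 t ht).mono fun x hx => by
      show ‖ρ x * G t x‖ₑ ^ 2 = ‖g t x‖ₑ ^ 2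
      rw [hx])]
    exact hgb t ht
  have hC₁ : ∀ t ∈ Icc 0 T, ∫⁻ x, ‖ρ x * timeDerivWithin (Icc 0 T) G t x‖ₑ ^ 2 ≤ C := fun t ht => by
    rw [lintegral_congr_ae ((e1 t ht).mono fun x hx => by
      show ‖ρ x * timeDerivWithin (Icc 0 T) G t x‖ₑ ^ 2 = ‖g' t x‖ₑ ^ 2
      rw [hx])]
    exact hg'b t ht
  obtain ⟨hI, hC, hB⟩ := Wei2016.weighted_sq_balance hT hGsm hρm hC₀ hC₁
  -- identification of the densities and energies
  have hd : ∀ t ∈ Icc 0 T, ∫ x, 2 * (ρ x * G t x) * (ρ x * timeDerivWithin (Icc 0 T) G t x) =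
      ∫ x, 2 * g t x * g' t x := fun t ht =>
    integral_congr_ae (((e0 t ht).and (e1 t ht)).mono fun x hx => by
      show 2 * (ρ x * G t x) * (ρ x * timeDerivWithin (Icc 0 T) G t x) = 2 * g t x * g' t x
      rw [hx.1, hx.2])
  have he : ∀ t ∈ Icc 0 T, ∫ x, (ρ x * G t x) ^ 2 = ∫ x, g t x ^ 2 := fun t ht =>
    integral_congr_ae ((e0 t ht).mono fun x hx => by
      show (ρ x * G t x) ^ 2 = g t x ^ 2
      rw [hx])
  refine ⟨?_, ?_, fun b hb => ?_⟩
  · exact hI.congr_fun (fun t ht => hd t (Ioo_subset_Icc_self ht)) measurableSet_Ioo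
  · exact hC.congr fun t ht => (he t ht).symm
  · have h := hB b hb
    rw [he b (Ioc_subset_Icc_self hb), he 0 ⟨le_rfl, hT.le⟩] at h
    rw [h]
    congr 1
    refine intervalIntegral.integral_congr fun t ht => ?_
    rw [uIcc_of_le hb.1.le] at ht
    exact hd t ⟨ht.1, ht.2.trans hb.2⟩

/-- **The `Ω`-balance with integrability and continuity** (`Ω(t) = angVortQuot (v t)`,
`Ω'(t) = angVortQuot (∂ₜv t)`). [cite: Wei2016, §3 (3.2) integrated] -/
theorem IsTaoSolutionOn.angVortQuot_balance (h : IsTaoSolutionOn T ν u₀ v q) (hT : 0 < T)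
    (hax : ∀ t ∈ Icc 0 T, IsAxisymmetric (v t)) :
    IntegrableOn (fun t => ∫ x, 2 * angVortQuot (v t) x * angVortQuot (timeDerivWithin (Icc 0 T) v t) x)
      (Ioo 0 T) ∧
    ContinuousOn (fun t => ∫ x, angVortQuot (v t) x ^ 2) (Icc 0 T) ∧
    ∀ b ∈ Ioc 0 T, ∫ x, angVortQuot (v b) x ^ 2 = (∫ x, angVortQuot (v 0) x ^ 2) +
      ∫ t in (0 : ℝ)..b, ∫ x, 2 * angVortQuot (v t) x * angVortQuot (timeDerivWithin (Icc 0 T) v t) x := by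
  have hU : UniqueDiffOn ℝ (Icc 0 T) := uniqueDiffOn_Icc hT
  have hsm : IsSmoothSpaceTimeOn (Icc 0 T) v := h.classical.smooth_velocity
  have hvs : ∀ t ∈ Icc 0 T, ContDiff ℝ ∞ (v t) := fun t ht => h.classical.contDiff_velocity ht
  have hws : ∀ t ∈ Icc 0 T, ContDiff ℝ ∞ (timeDerivWithin (Icc 0 T) v t) := fun t ht =>
    hsm.contDiff_timeDerivWithin_slice hU ht
  have hwax : ∀ t ∈ Icc 0 T, IsAxisymmetric (timeDerivWithin (Icc 0 T) v t) := fun t ht =>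
    hsm.isAxisymmetric_timeDerivWithin hax ht
  obtain ⟨C, hC⟩ := h.exists_lintegral_sq_quot_le hT hax
  refine h.weighted_balance_of_repr hT (a := rotGen) (g := fun t x => angVortQuot (v t) x)
    (g' := fun t x => angVortQuot (timeDerivWithin (Icc 0 T) v t) x) ?_ ?_ ?_
    (fun t ht => (hC t ht).1) (fun t ht => (hC t ht).2.1)
  · exact (rotGenL).contDiff
  · intro t ht x hx
    have h3 : ContDiff ℝ 3 (v t) := (hvs t ht).of_le (by norm_cast)
    have e := (hax t ht).cylRadius_sq_mul_angVortQuot h3 x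
    rw [swirl_eq_inner_rotGen] at e
    simp only at e
    show angVortQuot (v t) x = (cylRadius x ^ 2)⁻¹ * ⟪rotGen x, curl (v t) x⟫
    rw [← e, ← mul_assoc, inv_mul_cancel₀ (pow_ne_zero 2 hx), one_mul]
  · intro t ht x hx
    have h3 : ContDiff ℝ 3 (timeDerivWithin (Icc 0 T) v t) := (hws t ht).of_le (by norm_cast)
    have e := (hwax t ht).cylRadius_sq_mul_angVortQuot h3 x
    rw [swirl_eq_inner_rotGen] at e
    simp only at e
    show angVortQuot (timeDerivWithin (Icc 0 T) v t) x =
      (cylRadius x ^ 2)⁻¹ * ⟪rotGen x, curl (timeDerivWithin (Icc 0 T) v t) x⟫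
    rw [← e, ← mul_assoc, inv_mul_cancel₀ (pow_ne_zero 2 hx), one_mul]

/-- `⟪(x₀, x₁, 0), w⟫ = x₀w₀ + x₁w₁`. [folklore] -/
private theorem inner_horizontal' (x w : EuclideanSpace ℝ (Fin 3)) :
    ⟪(toLp 2 ![x 0, x 1, 0] : EuclideanSpace ℝ (Fin 3)), w⟫ = x 0 * w 0 + x 1 * w 1 := by
  simp [PiLp.inner_apply, Fin.sum_univ_three]
  ring

/-- The horizontal projection `x ↦ (x₀, x₁, 0)` is smooth (linear). [folklore] -/
private theorem contDiff_horizontal :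
    ContDiff ℝ ∞ fun x : EuclideanSpace ℝ (Fin 3) => (toLp 2 ![x 0, x 1, 0] : EuclideanSpace ℝ (Fin 3)) := by
  have h : (fun x : EuclideanSpace ℝ (Fin 3) => (toLp 2 ![x 0, x 1, 0] : EuclideanSpace ℝ (Fin 3))) =
      fun x => x 0 • EuclideanSpace.single 0 (1 : ℝ) + x 1 • EuclideanSpace.single 1 (1 : ℝ) := by
    funext x; exact toLp_horizontal_eq_add_single x
  rw [h]
  have hc : ∀ i : Fin 3, ContDiff ℝ ∞ fun x : EuclideanSpace ℝ (Fin 3) => (x i : ℝ) := fun i =>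
    (EuclideanSpace.proj (𝕜 := ℝ) i).contDiff
  exact ((hc 0).smul contDiff_const).add ((hc 1).smul contDiff_const)

/-- **The `J`-balance with integrability and continuity** (`J(t) = radVelQuot (curl (v t))`,
`J'(t) = radVelQuot (curl (∂ₜv t))`). [cite: Wei2016, §3 (3.1) integrated] -/
theorem IsTaoSolutionOn.radVelQuot_curl_balance (h : IsTaoSolutionOn T ν u₀ v q) (hT : 0 < T)
    (hax : ∀ t ∈ Icc 0 T, IsAxisymmetric (v t)) :
    IntegrableOn (fun t => ∫ x, 2 * radVelQuot (curl (v t)) x *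
        radVelQuot (curl (timeDerivWithin (Icc 0 T) v t)) x) (Ioo 0 T) ∧
    ContinuousOn (fun t => ∫ x, radVelQuot (curl (v t)) x ^ 2) (Icc 0 T) ∧
    ∀ b ∈ Ioc 0 T, ∫ x, radVelQuot (curl (v b)) x ^ 2 = (∫ x, radVelQuot (curl (v 0)) x ^ 2) +
      ∫ t in (0 : ℝ)..b, ∫ x, 2 * radVelQuot (curl (v t)) x *
        radVelQuot (curl (timeDerivWithin (Icc 0 T) v t)) x := by
  have hU : UniqueDiffOn ℝ (Icc 0 T) := uniqueDiffOn_Icc hT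
  have hsm : IsSmoothSpaceTimeOn (Icc 0 T) v := h.classical.smooth_velocity
  have hvs : ∀ t ∈ Icc 0 T, ContDiff ℝ ∞ (v t) := fun t ht => h.classical.contDiff_velocity ht
  have hws : ∀ t ∈ Icc 0 T, ContDiff ℝ ∞ (timeDerivWithin (Icc 0 T) v t) := fun t ht =>
    hsm.contDiff_timeDerivWithin_slice hU ht
  have hwax : ∀ t ∈ Icc 0 T, IsAxisymmetric (timeDerivWithin (Icc 0 T) v t) := fun t ht =>
    hsm.isAxisymmetric_timeDerivWithin hax ht
  have hcs : ∀ {w : EuclideanSpace ℝ (Fin 3) → EuclideanSpace ℝ (Fin 3)}, ContDiff ℝ ∞ w →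
      ContDiff ℝ 2 (curl w) := fun hw => by
    rw [curl_eq_curlCLM_comp]
    exact curlCLM.contDiff.comp ((hw.of_le (by norm_cast)).fderiv_right (m := 2) (by norm_cast))
  obtain ⟨C, hC⟩ := h.exists_lintegral_sq_quot_le hT hax
  refine h.weighted_balance_of_repr hT (a := fun x => toLp 2 ![x 0, x 1, 0])
    (g := fun t x => radVelQuot (curl (v t)) x)
    (g' := fun t x => radVelQuot (curl (timeDerivWithin (Icc 0 T) v t)) x) contDiff_horizontal ?_ ?_
    (fun t ht => (hC t ht).2.2.1) (fun t ht => (hC t ht).2.2.2)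
  · intro t ht x hx
    have hωax : IsAxisymmetric (curl (v t)) := (hax t ht).curl ((hvs t ht).differentiable (by simp))
    have e := hωax.cylRadius_sq_mul_radVelQuot (hcs (hvs t ht)) x
    show radVelQuot (curl (v t)) x =
      (cylRadius x ^ 2)⁻¹ * ⟪(toLp 2 ![x 0, x 1, 0] : EuclideanSpace ℝ (Fin 3)), curl (v t) x⟫
    rw [inner_horizontal', ← e, ← mul_assoc, inv_mul_cancel₀ (pow_ne_zero 2 hx), one_mul]
  · intro t ht x hx
    have hωax : IsAxisymmetric (curl (timeDerivWithin (Icc 0 T) v t)) :=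
      (hwax t ht).curl ((hws t ht).differentiable (by simp))
    have e := hωax.cylRadius_sq_mul_radVelQuot (hcs (hws t ht)) x
    show radVelQuot (curl (timeDerivWithin (Icc 0 T) v t)) x = (cylRadius x ^ 2)⁻¹ *
      ⟪(toLp 2 ![x 0, x 1, 0] : EuclideanSpace ℝ (Fin 3)), curl (timeDerivWithin (Icc 0 T) v t) x⟫
    rw [inner_horizontal', ← e, ← mul_assoc, inv_mul_cancel₀ (pow_ne_zero 2 hx), one_mul]

/-- **The energy `A(t) = ∫J(t)² + β∫Ω(t)²` along a Tao-class axisymmetric solution**: `A` is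
continuous on `[0, T]`, its density `φ(t) = ∫ 2JJ' + β ∫ 2ΩΩ'` is integrable on `(0, T)`, and
`A(t) − A(s) = ∫ₛᵗ φ` for `0 ≤ s ≤ t ≤ T` (Wei: `A = ‖J‖² + ½ε^{2/3}‖Ω‖²`, `β = ½ε^{2/3}`).
[cite: Wei2016, §3 (3.6) integrated] -/
theorem IsTaoSolutionOn.energyA_balance (h : IsTaoSolutionOn T ν u₀ v q) (hT : 0 < T)
    (hax : ∀ t ∈ Icc 0 T, IsAxisymmetric (v t)) (β : ℝ) :
    ContinuousOn (fun t => (∫ x, radVelQuot (curl (v t)) x ^ 2) + β * ∫ x, angVortQuot (v t) x ^ 2)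
      (Icc 0 T) ∧
    IntegrableOn (fun t => (∫ x, 2 * radVelQuot (curl (v t)) x *
        radVelQuot (curl (timeDerivWithin (Icc 0 T) v t)) x) +
      β * ∫ x, 2 * angVortQuot (v t) x * angVortQuot (timeDerivWithin (Icc 0 T) v t) x) (Ioo 0 T) ∧
    ∀ s t, 0 ≤ s → s ≤ t → t ≤ T →
      ((∫ x, radVelQuot (curl (v t)) x ^ 2) + β * ∫ x, angVortQuot (v t) x ^ 2) -
        ((∫ x, radVelQuot (curl (v s)) x ^ 2) + β * ∫ x, angVortQuot (v s) x ^ 2) =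
      ∫ τ in s..t, ((∫ x, 2 * radVelQuot (curl (v τ)) x *
          radVelQuot (curl (timeDerivWithin (Icc 0 T) v τ)) x) +
        β * ∫ x, 2 * angVortQuot (v τ) x * angVortQuot (timeDerivWithin (Icc 0 T) v τ) x) := by
  obtain ⟨iJ, cJ, bJ⟩ := h.radVelQuot_curl_balance hT hax
  obtain ⟨iΩ, cΩ, bΩ⟩ := h.angVortQuot_balance hT hax
  set φJ : ℝ → ℝ := fun t => ∫ x, 2 * radVelQuot (curl (v t)) x *
    radVelQuot (curl (timeDerivWithin (Icc 0 T) v t)) x with hφJ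
  set φΩ : ℝ → ℝ := fun t => ∫ x, 2 * angVortQuot (v t) x * angVortQuot (timeDerivWithin (Icc 0 T) v t) x
    with hφΩ
  set EJ : ℝ → ℝ := fun t => ∫ x, radVelQuot (curl (v t)) x ^ 2 with hEJ
  set EΩ : ℝ → ℝ := fun t => ∫ x, angVortQuot (v t) x ^ 2 with hEΩ
  refine ⟨cJ.add (continuousOn_const.mul cΩ), iJ.add (iΩ.const_mul β), fun s t hs hst htT => ?_⟩
  -- interval integrability on `[0, T]`
  have hII : ∀ {f : ℝ → ℝ}, IntegrableOn f (Ioo 0 T) → ∀ a b, 0 ≤ a → a ≤ b → b ≤ T →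
      IntervalIntegrable f volume a b := by
    intro f hf a b ha hab hb
    rw [intervalIntegrable_iff_integrableOn_Ioo_of_le hab]
    exact hf.mono_set (Ioo_subset_Ioo ha hb)
  -- `E(r) = E(0) + ∫₀ʳ φ` for `r ∈ [0, T]` (trivial at `r = 0`)
  have hbal : ∀ r, 0 ≤ r → r ≤ T →
      EJ r + β * EΩ r = (EJ 0 + β * EΩ 0) + ∫ τ in (0 : ℝ)..r, (φJ τ + β * φΩ τ) := by
    intro r hr0 hrT
    rcases hr0.eq_or_lt with h0 | hpos
    · rw [← h0, intervalIntegral.integral_same, add_zero]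
    · have hr : r ∈ Ioc 0 T := ⟨hpos, hrT⟩
      rw [intervalIntegral.integral_add (hII iJ 0 r le_rfl hpos.le hrT)
        ((hII iΩ 0 r le_rfl hpos.le hrT).const_mul β), intervalIntegral.integral_const_mul,
        show EJ r = EJ 0 + ∫ τ in (0 : ℝ)..r, φJ τ from bJ r hr,
        show EΩ r = EΩ 0 + ∫ τ in (0 : ℝ)..r, φΩ τ from bΩ r hr]
      ring
  have ht0 : 0 ≤ t := hs.trans hst
  have hsT : s ≤ T := hst.trans htT
  show (EJ t + β * EΩ t) - (EJ s + β * EΩ s) = ∫ τ in s..t, (φJ τ + β * φΩ τ)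
  rw [hbal t ht0 htT, hbal s hs hsT,
    ← intervalIntegral.integral_add_adjacent_intervals (a := 0) (b := s) (c := t)
      ((hII iJ 0 s le_rfl hs hsT).add ((hII iΩ 0 s le_rfl hs hsT).const_mul β))
      ((hII iJ s t hs hst htT).add ((hII iΩ s t hs hst htT).const_mul β))]
  ring

end Balance

end Literature.Analysis.FluidPDE

end
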